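import Literature.RingTheory.RegularLocalRing.SopPowersLength
import Literature.RingTheory.MvPolynomial.TruncatedMvPolynomialSurjectsLocalAlgebra
import Literature.AlgebraicGeometry.Resolution.PowerSeriesRegularLocal
import HarnessLib

/-!
# The quotient of a regular local ring by powers of a regular system of parameters — in particular
# the Frobenius-power quotient `A ⧸ 𝔪^{[q]}` — is a truncated polynomial algebra

`Literature/RingTheory/RegularLocalRing/FrobeniusPowerQuotient.lean`, namespace
`Literature.RingTheory.RegularLocalRing` (sequel of `SopPowersLength.lean`; the embedding-dimension
half is `EmbeddingDimensionQuotient.lean`). Everything is PROVED; no definitions, no named facts.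

Let `(A, 𝔪)` be a regular local ring of dimension `d` which is an algebra over a field `k` with trivial
residue extension (`∀ r, ∃ c : k, r - c ∈ 𝔪`; e.g. the local ring of a smooth `k`-scheme at a
`k`-rational point), `x₁, …, x_d` a regular system of parameters and `eᵢ ≥ 1`.

* §1 `finrank_truncated_le` — the truncated polynomial algebra `k[X₁, …, X_d] ⧸ (X₁^{e₁}, …, X_d^{e_d})`
  is spanned by the `∏ eᵢ` monomials `X^α`, `αᵢ < eᵢ`: finite over `k` of dimension `≤ ∏ eᵢ`
  (`span_monomials_eq_top_of_surjective`, `finrank_le_prod_of_surjective` for any quotient `k[X] ↠ B`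
  with `Xᵢ^{eᵢ} ↦ 0`).
* §2 **`nonempty_algEquiv_quotient_span_rsop_pow_truncated`** —
  **`A ⧸ (x₁^{e₁}, …, x_d^{e_d}) ≃ₐ[k] k[X₁, …, X_d] ⧸ (X₁^{e₁}, …, X_d^{e_d})`**: the surjection
  `k[X] → A ⧸ (x^e)`, `Xᵢ ↦ xᵢ` (Atiyah–Macdonald 8.8, tree
  `MvPolynomial.aeval_surjective_of_span_range_eq_maximalIdeal`) factors through the truncation, and
  the two sides have `k`-dimension `∏ eᵢ` (`SopPowersLength.finrank_quotient_span_rsop_pow`) resp.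
  `≤ ∏ eᵢ` (§1). The Frobenius form **`nonempty_algEquiv_quotient_map_iterateFrobenius_truncated`:
  `A ⧸ 𝔪^{[pⁿ]} ≃ₐ[k] k[X₁, …, X_d] ⧸ (X₁^{pⁿ}, …, X_d^{pⁿ})`** — «the kernel of the `pⁿ`-Frobenius of a
  smooth `d`-dimensional group is the truncated polynomial scheme» (a finite-level shadow of Cohen's
  structure theorem `Â ≅ k⟦X₁, …, X_d⟧`, Matsumura Thm. 28.3).
* §3 **`finrank_truncatedMvPolynomial`** — `dim_k k[X₁, …, X_d] ⧸ (X₁^{e₁}, …, X_d^{e_d}) = ∏ eᵢ` for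
  ALL exponents (the exact count left open in the docstring of tree
  `MvPolynomial/TruncatedMvPolynomialSurjectsLocalAlgebra`), via §2 for `A = k⟦X₁, …, X_d⟧` (tree
  `Resolution.isRegularLocalRing_mvPowerSeries_fin`); `finrank_truncatedMvPolynomial_const`:
  `dim_k k[X] ⧸ (Xᵢ^q) = q^d`.

## References

* [Matsumura1987] H. Matsumura, *Commutative Ring Theory*, CUP 1986, Thm. 28.3 (Cohen structure
  theorem), §14.
* [AtiyahMacdonald1969] M. F. Atiyah, I. G. Macdonald, *Introduction to Commutative Algebra*,
  Prop. 8.8 and the Example following it.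
* [Kunz1969] E. Kunz, Amer. J. Math. 91 (1969), proof of Thm. 2.1 (`R ⧸ 𝔪^{[p]}` for regular `R`).
-/

set_option autoImplicit false

namespace Literature.RingTheory.RegularLocalRing

universe u v

open IsLocalRing Module _root_.MvPolynomial
open Literature.AlgebraicGeometry.Resolution

/-! ## §1 Truncated polynomial algebras are spanned by the small monomials -/

section Truncated

variable {k : Type v} [Field k]

/-- In `k[X₁, …, X_d] ⧸ (X₁^{e₁}, …, X_d^{e_d})` the `k`-span of the monomials `∏ Xᵢ^{αᵢ}` with
`αᵢ < eᵢ` is stable under multiplication by each `X_n` (raise the `n`-th exponent; at `e_n` the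
product dies). [cite: AtiyahMacdonald1969, Ch. 8, Prop. 8.8 and Example] -/
private theorem mul_mem_span_monomials {B : Type u} [CommRing B] [Algebra k B] {d : ℕ}
    (s : Fin d → B) (e : Fin d → ℕ) (hs : ∀ i, s i ^ e i = 0) (n : Fin d) {v : B}
    (hv : v ∈ Submodule.span k
      (Set.range fun α : (∀ i : Fin d, Fin (e i)) => ∏ i, s i ^ (α i : ℕ))) :
    v * s n ∈ Submodule.span k
      (Set.range fun α : (∀ i : Fin d, Fin (e i)) => ∏ i, s i ^ (α i : ℕ)) := by
  classical
  induction hv using Submodule.span_induction with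
  | mem x hx =>
    obtain ⟨α, rfl⟩ := hx
    have hsplit : (∏ i, s i ^ (α i : ℕ)) * s n =
        s n ^ ((α n : ℕ) + 1) * ∏ i ∈ Finset.univ.erase n, s i ^ (α i : ℕ) := by
      rw [← Finset.mul_prod_erase Finset.univ (fun i => s i ^ (α i : ℕ)) (Finset.mem_univ n)]
      ring
    by_cases h : (α n : ℕ) + 1 < e n
    · let α' : ∀ i : Fin d, Fin (e i) := Function.update α n ⟨(α n : ℕ) + 1, h⟩
      have hα' : (∏ i, s i ^ (α' i : ℕ)) =
          s n ^ ((α n : ℕ) + 1) * ∏ i ∈ Finset.univ.erase n, s i ^ (α i : ℕ) := by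
        rw [← Finset.mul_prod_erase Finset.univ (fun i => s i ^ (α' i : ℕ)) (Finset.mem_univ n)]
        congr 1
        · simp [α']
        · refine Finset.prod_congr rfl fun i hi => ?_
          have hin : i ≠ n := Finset.ne_of_mem_erase hi
          simp [α', Function.update_of_ne hin]
      rw [hsplit, ← hα']
      exact Submodule.subset_span ⟨α', rfl⟩
    · have hq' : (α n : ℕ) + 1 = e n := by have := (α n).2; omega
      rw [hsplit, hq', hs n, zero_mul]
      exact Submodule.zero_mem _
  | zero => rw [zero_mul]; exact Submodule.zero_mem _
  | add x y _ _ hx hy => rw [add_mul]; exact Submodule.add_mem _ hx hy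
  | smul c x _ hx => rw [smul_mul_assoc]; exact Submodule.smul_mem _ c hx

/-- If `k[X₁, …, X_d] → B`, `Xᵢ ↦ sᵢ`, is surjective and `sᵢ^{eᵢ} = 0` with all `eᵢ ≥ 1`, then `B` is
`k`-spanned by the monomials `∏ sᵢ^{αᵢ}`, `αᵢ < eᵢ`. [cite: AtiyahMacdonald1969, Ch. 8, Prop. 8.8 and Example] -/
theorem span_monomials_eq_top_of_surjective {B : Type u} [CommRing B] [Algebra k B] {d : ℕ}
    (s : Fin d → B) (e : Fin d → ℕ) (he : ∀ i, 1 ≤ e i) (hs : ∀ i, s i ^ e i = 0)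
    (hsurj : Function.Surjective (aeval (R := k) s)) :
    Submodule.span k (Set.range fun α : (∀ i : Fin d, Fin (e i)) => ∏ i, s i ^ (α i : ℕ)) = ⊤ := by
  classical
  rw [eq_top_iff]
  rintro b -
  obtain ⟨f, rfl⟩ := hsurj b
  induction f using MvPolynomial.induction_on with
  | C a =>
    rw [aeval_C, Algebra.algebraMap_eq_smul_one]
    refine Submodule.smul_mem _ a (Submodule.subset_span ⟨fun i => ⟨0, he i⟩, ?_⟩)
    simp
  | add p q hp hq => rw [map_add]; exact Submodule.add_mem _ hp hq
  | mul_X p n hp => rw [map_mul, aeval_X]; exact mul_mem_span_monomials s e hs n hp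

/-- **`dim_k B ≤ ∏ eᵢ`** (and `B` is finite over `k`) under the hypotheses of
`span_monomials_eq_top_of_surjective`. [cite: AtiyahMacdonald1969, Ch. 8, Prop. 8.8 and Example] -/
theorem finrank_le_prod_of_surjective {B : Type u} [CommRing B] [Algebra k B] {d : ℕ}
    (s : Fin d → B) (e : Fin d → ℕ) (he : ∀ i, 1 ≤ e i) (hs : ∀ i, s i ^ e i = 0)
    (hsurj : Function.Surjective (aeval (R := k) s)) :
    Module.Finite k B ∧ Module.finrank k B ≤ ∏ i, e i := by
  classical
  have h := span_monomials_eq_top_of_surjective s e he hs hsurj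
  have hfin : Module.Finite k B := by
    haveI := Module.Finite.span_of_finite k
      (Set.finite_range fun α : (∀ i : Fin d, Fin (e i)) => ∏ i, s i ^ (α i : ℕ))
    rw [h] at this
    exact Module.Finite.of_surjective (⊤ : Submodule k B).subtype
      (fun b => ⟨⟨b, Submodule.mem_top⟩, rfl⟩)
  refine ⟨hfin, ?_⟩
  have hle := finrank_range_le_card (R := k) fun α : (∀ i : Fin d, Fin (e i)) => ∏ i, s i ^ (α i : ℕ)
  rw [Fintype.card_pi] at hle
  simp only [Fintype.card_fin] at hle
  rw [← finrank_top, ← h]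
  exact hle

/-- **The truncated polynomial algebra `k[X₁, …, X_d] ⧸ (X₁^{e₁}, …, X_d^{e_d})` (`eᵢ ≥ 1`) is finite
over `k` of dimension at most `∏ eᵢ`.** (Equality: `finrank_truncatedMvPolynomial` below.)
[cite: AtiyahMacdonald1969, Ch. 8, Prop. 8.8 and Example] -/
theorem finrank_truncated_le {d : ℕ} (e : Fin d → ℕ) (he : ∀ i, 1 ≤ e i) :
    Module.Finite k (MvPolynomial (Fin d) k ⧸
        Ideal.span (Set.range fun i => (X i : MvPolynomial (Fin d) k) ^ e i)) ∧
      Module.finrank k (MvPolynomial (Fin d) k ⧸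
        Ideal.span (Set.range fun i => (X i : MvPolynomial (Fin d) k) ^ e i)) ≤ ∏ i, e i := by
  set J : Ideal (MvPolynomial (Fin d) k) := Ideal.span (Set.range fun i => (X i) ^ e i) with hJ
  set s : Fin d → MvPolynomial (Fin d) k ⧸ J := fun i => Ideal.Quotient.mk J (X i) with hsdef
  have hs : ∀ i, s i ^ e i = 0 := fun i => by
    rw [hsdef, ← map_pow, Ideal.Quotient.eq_zero_iff_mem]
    exact Ideal.subset_span ⟨i, rfl⟩
  have haeval : aeval (R := k) s = Ideal.Quotient.mkₐ k J :=
    MvPolynomial.algHom_ext fun i => by rw [aeval_X, hsdef, Ideal.Quotient.mkₐ_eq_mk]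
  have hsurj : Function.Surjective (aeval (R := k) s) := by
    rw [haeval]
    exact Ideal.Quotient.mkₐ_surjective k J
  exact finrank_le_prod_of_surjective s e he hs hsurj

end Truncated

/-! ## §2 Structure: `A ⧸ (x₁^{e₁}, …, x_d^{e_d}) ≃ₐ[k] k[X₁, …, X_d] ⧸ (X₁^{e₁}, …, X_d^{e_d})` -/

section Structure

variable {A : Type u} [CommRing A] {k : Type v} [Field k]

/-- **Quotients of a regular local ring by powers of a regular system of parameters are truncated
polynomial algebras.** Let `(A, 𝔪)` be a regular local ring of dimension `d`, a `k`-algebra with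
trivial residue extension (`hres`), `x₁, …, x_d` a regular system of parameters (`𝔪 = (x)`) and
`eᵢ ≥ 1`. Then `A ⧸ (x₁^{e₁}, …, x_d^{e_d}) ≃ₐ[k] k[X₁, …, X_d] ⧸ (X₁^{e₁}, …, X_d^{e_d})`, `Xᵢ ↦ xᵢ`:
the map is onto (A–M 8.8, tree `aeval_surjective_of_span_range_eq_maximalIdeal`) and both sides have
dimension `∏ eᵢ` (tree `finrank_quotient_span_rsop_pow`; `finrank_truncated_le`). A finite-level
form of Cohen's structure theorem `Â ≅ k⟦X₁, …, X_d⟧`. [cite: Matsumura1987, Thm. 28.3]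
[cite: AtiyahMacdonald1969, Ch. 8, Prop. 8.8 and Example] -/
theorem nonempty_algEquiv_quotient_span_rsop_pow_truncated [IsRegularLocalRing A] [Algebra k A]
    (hres : ∀ r : A, ∃ c : k, r - algebraMap k A c ∈ maximalIdeal A) {d : ℕ} (x : Fin d → A)
    (hx : Ideal.span (Set.range x) = maximalIdeal A) (hd : ringKrullDim A = d) (e : Fin d → ℕ)
    (he : ∀ i, 1 ≤ e i) :
    Nonempty ((A ⧸ Ideal.span (Set.range fun i => x i ^ e i)) ≃ₐ[k]
      (MvPolynomial (Fin d) k ⧸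
        Ideal.span (Set.range fun i => (X i : MvPolynomial (Fin d) k) ^ e i))) := by
  classical
  set I : Ideal A := Ideal.span (Set.range fun i => x i ^ e i) with hI
  set J : Ideal (MvPolynomial (Fin d) k) := Ideal.span (Set.range fun i => (X i) ^ e i) with hJ
  -- `I ⊆ 𝔪`, so `A ⧸ I` is a local ring with maximal ideal `𝔪/I`
  have hIm : I ≤ maximalIdeal A := by
    refine Ideal.span_le.mpr ?_
    rintro _ ⟨i, rfl⟩
    exact Ideal.pow_mem_of_mem _ (hx ▸ Ideal.subset_span ⟨i, rfl⟩) _ (he i)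
  have hItop : I ≠ ⊤ := fun h => (maximalIdeal.isMaximal A).ne_top (top_le_iff.mp (h ▸ hIm))
  haveI : Nontrivial (A ⧸ I) := Ideal.Quotient.nontrivial_iff.mpr hItop
  haveI : IsLocalRing (A ⧸ I) :=
    IsLocalRing.of_surjective' (Ideal.Quotient.mk I) Ideal.Quotient.mk_surjective
  have hmB : maximalIdeal (A ⧸ I) = (maximalIdeal A).map (Ideal.Quotient.mk I) :=
    (map_maximalIdeal_of_surjective (Ideal.Quotient.mk I) Ideal.Quotient.mk_surjective).symm
  -- the images `sᵢ` of the `xᵢ` generate `𝔪/I`, the residue field is `k`, `𝔪/I` is nilpotent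
  set s : Fin d → A ⧸ I := fun i => Ideal.Quotient.mk I (x i) with hsdef
  have hs : Ideal.span (Set.range s) = maximalIdeal (A ⧸ I) := by
    rw [hmB, ← hx, Ideal.map_span, ← Set.range_comp]
    rfl
  have hresB : ∀ b : A ⧸ I, ∃ c : k, b - algebraMap k (A ⧸ I) c ∈ maximalIdeal (A ⧸ I) := by
    intro b
    obtain ⟨a, rfl⟩ := Ideal.Quotient.mk_surjective b
    obtain ⟨c, hc⟩ := hres a
    refine ⟨c, ?_⟩
    rw [hmB, ← Ideal.Quotient.mk_algebraMap, ← map_sub]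
    exact Ideal.mem_map_of_mem _ hc
  have hnil : IsNilpotent (maximalIdeal (A ⧸ I)) := by
    refine ⟨d * (∑ i, e i) + 1, ?_⟩
    rw [hmB, ← Ideal.map_pow, Ideal.zero_eq_bot, Ideal.map_eq_bot_iff_le_ker, Ideal.mk_ker]
    exact maximalIdeal_pow_le_span_range_pow x hx fun i =>
      Finset.single_le_sum (fun j _ => Nat.zero_le (e j)) (Finset.mem_univ i)
  have hsq : ∀ i, s i ^ e i = 0 := fun i => by
    rw [hsdef, ← map_pow, Ideal.Quotient.eq_zero_iff_mem]
    exact Ideal.subset_span ⟨i, rfl⟩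
  -- A–M 8.8: `k[X] → A ⧸ I`, `Xᵢ ↦ sᵢ`, is onto; it kills `Xᵢ^{eᵢ}`
  have hsurj :=
    Literature.RingTheory.MvPolynomial.aeval_surjective_of_span_range_eq_maximalIdeal s hs hresB hnil
  have hJker : ∀ f ∈ J, aeval (R := k) s f = 0 := by
    have hle : J ≤ RingHom.ker (aeval (R := k) s) := by
      refine Ideal.span_le.mpr ?_
      rintro _ ⟨i, rfl⟩
      rw [SetLike.mem_coe, RingHom.mem_ker, map_pow, aeval_X, hsq]
    exact fun f hf => hle hf
  set ψ : (MvPolynomial (Fin d) k ⧸ J) →ₐ[k] (A ⧸ I) := Ideal.Quotient.liftₐ J (aeval s) hJker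
    with hψ
  have hψsurj : Function.Surjective ψ := by
    intro b
    obtain ⟨f, hf⟩ := hsurj b
    exact ⟨Ideal.Quotient.mk J f, by rw [hψ, ← hf]; rfl⟩
  -- dimensions: `dim (A ⧸ I) = ∏ eᵢ`, `dim (k[X] ⧸ J) ≤ ∏ eᵢ`; so `ψ` is injective
  obtain ⟨hfinB, hdimB⟩ := finrank_quotient_span_rsop_pow hres x hx hd e he
  obtain ⟨hfinT, hdimT⟩ := finrank_truncated_le (k := k) e he
  have hdimB' : Module.finrank k (A ⧸ I) = ∏ i, e i := hdimB
  have hdimT' : Module.finrank k (MvPolynomial (Fin d) k ⧸ J) ≤ ∏ i, e i := hdimT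
  have hψinj : Function.Injective ψ := by
    have h1 := LinearMap.finrank_range_add_finrank_ker ψ.toLinearMap
    have hrange : LinearMap.range ψ.toLinearMap = ⊤ := LinearMap.range_eq_top.mpr hψsurj
    rw [hrange, finrank_top] at h1
    have hker0 : Module.finrank k (LinearMap.ker ψ.toLinearMap) = 0 := by omega
    have hker : LinearMap.ker ψ.toLinearMap = ⊥ := Submodule.finrank_eq_zero.mp hker0
    exact LinearMap.ker_eq_bot.mp hker
  exact ⟨(AlgEquiv.ofBijective ψ ⟨hψinj, hψsurj⟩).symm⟩

/-- **The Frobenius-power quotient of a regular local ring is a truncated polynomial algebra**: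
`A ⧸ 𝔪^{[pⁿ]} ≃ₐ[k] k[X₁, …, X_d] ⧸ (X₁^{pⁿ}, …, X_d^{pⁿ})` for `(A, 𝔪)` regular local of dimension `d`
over the coefficient field `k` (trivial residue extension), of exponential characteristic `p`. For
the local ring at the origin of a smooth `d`-dimensional group this is the classical description of
the kernel of the `pⁿ`-Frobenius as the truncated polynomial scheme. [cite: Matsumura1987, Thm. 28.3]
[cite: Kunz1969, Thm. 2.1 (proof)] -/
theorem nonempty_algEquiv_quotient_map_iterateFrobenius_truncated [IsRegularLocalRing A]
    [Algebra k A] (hres : ∀ r : A, ∃ c : k, r - algebraMap k A c ∈ maximalIdeal A) (p : ℕ)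
    [ExpChar A p] (n : ℕ) {d : ℕ} (hd : ringKrullDim A = d) :
    Nonempty ((A ⧸ (maximalIdeal A).map (iterateFrobenius A p n)) ≃ₐ[k]
      (MvPolynomial (Fin d) k ⧸
        Ideal.span (Set.range fun i => (X i : MvPolynomial (Fin d) k) ^ p ^ n))) := by
  obtain ⟨x, hx⟩ := exists_rsop_of_ringKrullDim_eq (A := A) hd
  have hq : 1 ≤ p ^ n := Nat.one_le_pow _ _ (expChar_pos A p)
  have hJ : (maximalIdeal A).map (iterateFrobenius A p n) =
      Ideal.span (Set.range fun i => x i ^ p ^ n) := by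
    rw [← hx, map_iterateFrobenius_span_range]
  obtain ⟨ε⟩ := nonempty_algEquiv_quotient_span_rsop_pow_truncated hres x hx hd (fun _ => p ^ n)
    fun _ => hq
  exact ⟨(Ideal.quotientEquivAlgOfEq k hJ).trans ε⟩

end Structure

/-! ## §3 The count `dim_k k[X₁, …, X_d] ⧸ (X₁^{e₁}, …, X_d^{e_d}) = ∏ eᵢ` -/

section Count

variable (k : Type v) [Field k]

/-- Every power series is congruent to its constant term modulo the maximal ideal of
`k⟦X₁, …, X_d⟧` (trivial residue extension). [folklore] -/
private theorem mvPowerSeries_hres (d : ℕ) (f : MvPowerSeries (Fin d) k) :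
    ∃ c : k, f - algebraMap k (MvPowerSeries (Fin d) k) c ∈
      maximalIdeal (MvPowerSeries (Fin d) k) := by
  refine ⟨MvPowerSeries.constantCoeff f, ?_⟩
  rw [IsLocalRing.mem_maximalIdeal, mem_nonunits_iff, MvPowerSeries.isUnit_iff_constantCoeff,
    map_sub, ← MvPowerSeries.c_eq_algebraMap, MvPowerSeries.constantCoeff_C, sub_self]
  exact not_isUnit_zero

/-- **`dim_k k[X₁, …, X_d] ⧸ (X₁^{e₁}, …, X_d^{e_d}) = e₁ ⋯ e_d`** for a field `k` and exponents
`eᵢ ≥ 1`: by §3 the truncated polynomial algebra is `k⟦X⟧ ⧸ (X₁^{e₁}, …, X_d^{e_d})`, whose dimension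
is `∏ eᵢ` (`SopPowersLength`, `k⟦X₁, …, X_d⟧` being regular local of dimension `d` with the variables
as a regular system of parameters). [cite: AtiyahMacdonald1969, Ch. 8, Prop. 8.8 and Example] -/
theorem finrank_truncatedMvPolynomial_of_one_le {d : ℕ} (e : Fin d → ℕ) (he : ∀ i, 1 ≤ e i) :
    Module.finrank k (MvPolynomial (Fin d) k ⧸
        Ideal.span (Set.range fun i => (X i : MvPolynomial (Fin d) k) ^ e i)) = ∏ i, e i := by
  haveI := (isRegularLocalRing_mvPowerSeries_fin k d).1
  have hd := (isRegularLocalRing_mvPowerSeries_fin k d).2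
  have hx : Ideal.span (Set.range (MvPowerSeries.X : Fin d → MvPowerSeries (Fin d) k)) =
      maximalIdeal (MvPowerSeries (Fin d) k) := (maximalIdeal_mvPowerSeries_eq_span k (Fin d)).symm
  obtain ⟨ε⟩ := nonempty_algEquiv_quotient_span_rsop_pow_truncated (mvPowerSeries_hres k d)
    MvPowerSeries.X hx hd e he
  rw [← ε.toLinearEquiv.finrank_eq]
  exact (finrank_quotient_span_rsop_pow (mvPowerSeries_hres k d) MvPowerSeries.X hx hd e he).2

/-- **`dim_k k[X₁, …, X_d] ⧸ (X₁^{e₁}, …, X_d^{e_d}) = e₁ ⋯ e_d` for ALL exponents** (if some `eᵢ = 0`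
both sides vanish: the ideal contains `Xᵢ⁰ = 1`). [cite: AtiyahMacdonald1969, Ch. 8, Prop. 8.8 and Example] -/
theorem finrank_truncatedMvPolynomial {d : ℕ} (e : Fin d → ℕ) :
    Module.finrank k (MvPolynomial (Fin d) k ⧸
        Ideal.span (Set.range fun i => (X i : MvPolynomial (Fin d) k) ^ e i)) = ∏ i, e i := by
  by_cases he : ∀ i, 1 ≤ e i
  · exact finrank_truncatedMvPolynomial_of_one_le k e he
  · push Not at he
    obtain ⟨i, hi⟩ := he
    have hi0 : e i = 0 := by omega
    have htop : Ideal.span (Set.range fun j => (X j : MvPolynomial (Fin d) k) ^ e j) = ⊤ := by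
      rw [Ideal.eq_top_iff_one]
      have h := Ideal.subset_span (s := Set.range fun j => (X j : MvPolynomial (Fin d) k) ^ e j)
        ⟨i, rfl⟩
      simpa [hi0] using h
    rw [Finset.prod_eq_zero (Finset.mem_univ i) hi0]
    haveI : Subsingleton (MvPolynomial (Fin d) k ⧸
        Ideal.span (Set.range fun j => (X j : MvPolynomial (Fin d) k) ^ e j)) :=
      Ideal.Quotient.subsingleton_iff.mpr htop
    exact Module.finrank_zero_of_subsingleton

/-- **`dim_k k[X₁, …, X_d] ⧸ (X₁^q, …, X_d^q) = q^d`** — the order of the truncated polynomial scheme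
of exponent `q` (e.g. the kernel of the `q`-Frobenius of a smooth `d`-dimensional group, `q = pⁿ`).
[cite: AtiyahMacdonald1969, Ch. 8, Prop. 8.8 and Example] -/
theorem finrank_truncatedMvPolynomial_const (d q : ℕ) :
    Module.finrank k (MvPolynomial (Fin d) k ⧸
        Ideal.span (Set.range fun i => (X i : MvPolynomial (Fin d) k) ^ q)) = q ^ d := by
  rw [finrank_truncatedMvPolynomial k fun _ : Fin d => q, Finset.prod_const, Finset.card_univ,
    Fintype.card_fin]

/-- The truncated polynomial algebra of exponents `eᵢ ≥ 1` is finite over `k` (restated from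
`finrank_truncated_le` for convenience). [cite: AtiyahMacdonald1969, Ch. 8, Prop. 8.8 and Example] -/
theorem finite_truncatedMvPolynomial {d : ℕ} (e : Fin d → ℕ) (he : ∀ i, 1 ≤ e i) :
    Module.Finite k (MvPolynomial (Fin d) k ⧸
        Ideal.span (Set.range fun i => (X i : MvPolynomial (Fin d) k) ^ e i)) :=
  (finrank_truncated_le (k := k) e he).1

end Count

end Literature.RingTheory.RegularLocalRing
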